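import Summits.BirchSwinnertonDyer.BirchSwinnertonDyer.Theorems.KimAtThreeDeepLowerKatoCiteOnlyNine
import HarnessLib

/-!
# Crux `DeepLowerAtThree` (stmt-BirchSwinnertonDyer-19075) — skeleton of record, cite-only shape (line `katoLit`)
# (cell `bsd-addord`, seat w2-c2 gen 10; 2026-08-27; supersedes the birth split `Lines/birth.lean` Ш-trivial / Ш-non-trivial,
#  whose two stubs were each crux-sized and are closed by the same composition below)

The crux BY NAME is the composition `KimAtThreeDeepLowerKatoCiteOnlyNine.deepLowerAtThree_of_nineCites` (p544671) of SIX stubs,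
every one of which is a CITE-ONLY named statement (no construction-shaped input is displayed):
* `stub_leaves` — the conjunction of the four route leaves (items of `route-BirchSwinnertonDyer-KimAtThreeKolyvagin`, held
  PUB): `SakamotoKolyvaginThree` [Sakamoto 2024 Thm. 4.4], `RankEqAnalyticRankLeOne` [Gross–Zagier–Kolyvagin],
  `PoitouTateSelmerDuality` [Poitou–Tate / Mazur–Rubin], `CarayolLevelEqConductor` [Carayol 1986];
* `stub_P123`, `stub_DR`, `stub_S5a`, `stub_S5bTower` — four `p`-adic Hodge facts of
  `Literature/NumberTheory/PAdicHodge/DualExpElliptic{,Tower}` [Kato LNM 1553 II Prop. 1.2.3 / Ex. 1.3.5 / Thm. 1.4.1;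
  Bloch–Kato 1990 §3 Prop. 3.8 / Ex. 3.11] (Literature `def … : Prop`); the single-field (S5b) is NOT a stub any more — it is
  the Literature THEOREM `exists_smul_range_expStarCoord_iff_trace_log_of_tower stub_S5bTower` (kim3 g17, p542762);
* `stub_KatoLit` — Kato 2004 with DEFINED `exp*`: `Literature.NumberTheory.EllipticCurves.Kato2004.exists_eulerSystem_definedExpStar_values`
  [(8.1.3)/Ex. 13.3, Prop. 8.12, §9.4, Thm. 9.7, Thm. 6.6 (1)] (Literature `def … : Prop`, w2-c2 g9, p534555).
Sorries ONLY in `stub_*`. Everything between the stubs and the crux (Kato ES → Kolyvagin system at `3`, Mazur–Rubin rigidity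
on the deep Frobenius class, the local lattices, the moment-calculus dictionary, the off-stratum rows, the bridge Literature ↔
cell currency) is kernel-checked in `Theorems/KimAtThreeDeepLower*`, `…DeepUpper*`, `…FineKato*`, `…Kolyvagin*`,
`Rank1Residual/GaloisImage/*` (seats w2-c2 g0–g10, w2-c3, kim3, w2-c4, w2-c5, w2-acc1–5, w2-kport, w2-tamdiv; cell b2b-bsdres
team n1011). Nothing is booked; BSD / 19075 are NOT proved by this file (the stubs are unproved published results).
-/

noncomputable section

-- the cell's namespace `Summit.BirchSwinnertonDyer.BirchSwinnertonDyer.…` repeats the summit name by design (D-0017)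
set_option linter.dupNamespace false

open Literature.NumberTheory.EllipticCurves Literature.NumberTheory.PAdicHodge
open Literature.NumberTheory.EllipticCurves.Kato2004
open Summit.BirchSwinnertonDyer.BirchSwinnertonDyer.Theses.KimAtThreeKolyvagin
open Summit.BirchSwinnertonDyer.BirchSwinnertonDyer.Theorems

namespace Summit.BirchSwinnertonDyer.BirchSwinnertonDyer.Cruxes.DeepLowerAtThree.KatoLit

/-- STUB (route leaves, held PUB; items of the route): Sakamoto 2024 Thm. 4.4 ∧ Gross–Zagier–Kolyvagin ∧ Poitou–Tate ∧ Carayol 1986. -/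
theorem stub_leaves :
    SakamotoKolyvaginThree ∧ RankEqAnalyticRankLeOne ∧ PoitouTateSelmerDuality ∧ CarayolLevelEqConductor := by
  sorry

/-- STUB (cite fact, Kato LNM 1553 II Prop. 1.2.3; Literature `def`): (P123). -/
theorem stub_P123 : cupLogInjective_and_hasDualExp_of_isDeRham := by
  sorry

/-- STUB (cite fact, Kato LNM 1553 II Ex. 1.3.5 / Fontaine 1982; Literature `def`): (DR). -/
theorem stub_DR : isDeRham_restrictedRationalTateRep := by
  sorry

/-- STUB (cite fact, [BK90] §3 Prop. 3.8 / Ex. 3.11; Literature `def`): (S5a). -/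
theorem stub_S5a : expStarCoord_eq_zero_iff_kummer := by
  sorry

/-- STUB (cite fact, Kato II Thm. 1.4.1 + [BK90] 3.8 at two levels of a tower; Literature `def`): (S5b-tower). -/
theorem stub_S5bTower : exists_smul_range_expStarCoord_tower_iff_trace_log := by
  sorry

/-- STUB (cite fact, Kato 2004 (8.1.3)/Ex. 13.3, Prop. 8.12, §9.4, Thm. 9.7, Thm. 6.6 (1) with DEFINED `exp*`; Literature
`def`, w2-c2 g9, p534555). -/
theorem stub_KatoLit : Kato2004.exists_eulerSystem_definedExpStar_values := by
  sorry

/-- **The assembly of record (kernel-checked BY NAME): crux 19075 ⟸ the six cite stubs** (p544671's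
`deepLowerAtThree_of_nineCites`; (S5b) supplied inside by kim3's Literature theorem). -/
theorem DeepLowerAtThree_of :
    Summit.BirchSwinnertonDyer.BirchSwinnertonDyer.Theses.KimAtThreeKolyvagin.DeepLowerAtThree :=
  KimAtThreeDeepLowerKatoCiteOnlyNine.deepLowerAtThree_of_nineCites
    stub_leaves.1 stub_leaves.2.1 stub_leaves.2.2.1
    stub_P123 stub_DR stub_S5a stub_S5bTower stub_KatoLit stub_leaves.2.2.2

end Summit.BirchSwinnertonDyer.BirchSwinnertonDyer.Cruxes.DeepLowerAtThree.KatoLit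

end
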